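import Summits.BirchSwinnertonDyer.BirchSwinnertonDyer.Theorems.PrintCf2RamifiedOffTYZPartnerShaSelmerR2Prime
import Summits.BirchSwinnertonDyer.BirchSwinnertonDyer.Theorems.PrintCf2RamifiedOffTYZBlockFreeRho
import Summits.BirchSwinnertonDyer.BirchSwinnertonDyer.Theorems.PrintCf2RamifiedOffTYZGeneratorDepthRhoOne
import HarnessLib

/-!
# Crux `PrintCf2.RamifiedOffTYZOfFacts` (stmt-BirchSwinnertonDyer-20509), line `offtyz-v7`, LEAD cycle 21 (cruxlead-20509 g20), part 7:
# C⁺ ON R2 ∩ {`Ш(A_n)[2] = 0`} IS THE SINGLE BIT `[P(n)]`, WITH THE `#Sel₄` HYPOTHESIS DISCHARGED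

THEOREMS ONLY (no `def`, no named fact introduced, no `sorry`), `--supports stmt-BirchSwinnertonDyer-20509` (C⁺ = item 23431
`RamifiedJumpOneLevelTwoOfFacts`).  HONEST FRAMING: assembly of this cycle's T1 on R2 (`PartnerSha.rhoIndex_ne_one_and_selmerFour_of_partner_R2`,
CT-free: `Ш(A_{lq})[2] = 0 ∧ rank 1 ∧ #Sel₂ = 2⁵ ⟹ ρ ≠ 0 ∧ #Sel₄ = 2⁶`) with cruxlead g18's `ρ = 1` door on the block-free family
(`GeneratorDepth.levelTwo_iff_genusPoint_not_twoDivisible_of_rhoIndex_eq_two`, `…two_dvd_scriptL_of_rhoIndex_eq_two_of_displays`: granted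
Tian–Yuan–Zhang §3 AS DISPLAYED + GZK).  The only new lemma is `ρ ≤ 1` on the rank-one leaf (`rhoIndex_eq_two_of_ne_one`, the «`2R = ψ(φ R)`»
step of `BlockFreeStructure.rhoIndex_eq_two_of_X_sq`).  Nothing is asserted; C⁺ and the crux stay OPEN; BSD is not proved by any of this.

* `rhoIndex_eq_two_of_ne_one` — square-free `n`, `rank E_n(ℚ) = 1`, `ρ(n) ≠ 0 ⟹ [E_n(ℚ) : φ_n(A_n(ℚ)) + E_n[2]] = 2`.
* `noBlock_R2`, `mod_eight_R2` — `n = lq` (`l ≡ 1`, `q ≡ 7 (mod 8)`) is `≡ 7 (mod 8)` with no divisor `≡ 5 (mod 8)` (block-free).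
* **`two_dvd_scriptL_of_partner_R2`** — on R2 with `r_an(E_{lq}) = 1`, `#Sel₂(E_{lq}) = 2⁵`, `Ш(A_{lq})[2] = 0`, granted GZK and the displays
  (`tyz_cmPointCompositumData`): **`2 ∣ 𝓛(lq)`** (the LOWER half of C⁺ there — g18's `ρ = 1` lower half with `ρ = 1` now DERIVED).
* **`levelTwo_iff_genusPoint_not_twoDivisible_of_partner_R2`** — same hypotheses, display form (`D : GenusPointData (lq)`): the conclusion of C⁺
  at `lq` (`2 ∣ L ∧ 4 ∤ L` for every `L` with `𝓛² = L²`) **⟺ TYZ's genus point `P(lq)` is not `2`-divisible in `A(ℍ′_{lq})` modulo torsion**.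
  On this sub-sector the hypothesis `#Sel₄(E_n) = 2⁶` of item 23431 is NOT assumed — it is a CONSEQUENCE (T1) — so the statement is a
  legitimately `Sel₄`-free residual of C⁺: the non-divisibility of one Heegner-type point («Kolyvagin exactness at `2`»), beyond print.

References: [cite: TianYuanZhang2017, §1 (p0002 L101–L110: ρ(n)), §3.1 (p0011 L27–L36, L58–L66), Thm. 3.5 (p0011 L94–L100), Lemma 3.18];
[cite: SilvermanAEC2009, Thm. X.4.2(a), Prop. X.4.9]; [cite: SilvermanTate2015, §3.4 Prop. 3.7 (ψ ∘ φ = [2])]; [cite: Darmon2004, Thm. 3.22];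
tree: parts 1–6 (`…PartnerSha*`), g18 `…GeneratorDepthRhoOne`, `…BlockFreeRho`.
-/

noncomputable section

open scoped Classical

open WeierstrassCurve WeierstrassCurve.Affine WeierstrassCurve.Affine.Point
  Literature.NumberTheory.EllipticCurves Literature.NumberTheory.EllipticCurves.Rank1Residual
  Summit.BirchSwinnertonDyer.Rank1Residual
  Literature.NumberTheory.EllipticCurves.TianYuanZhang2017
  Literature.NumberTheory.EllipticCurves.TianYuanZhang2017.W2
  Summit.BirchSwinnertonDyer.PrintCf2.GeneratorDepth
  Summit.BirchSwinnertonDyer.PrintCf2.BlockFreeStructure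

set_option autoImplicit false

namespace Summit.BirchSwinnertonDyer.PrintCf2.PartnerSha

/-! ## §11 `ρ ≤ 1` on the rank-one leaf, and the assembly on R2 -/

/-- **`ρ(n) ≤ 1` when `rank E_n(ℚ) = 1`, hence `ρ(n) ≠ 0 ⟹ [E_n(ℚ) : φ_n(A_n(ℚ)) + E_n[2]] = 2`.** (`2^ρ` is the index; `ψ(α) = ±2^ρ R + t₂`
for generators `R`, `α` modulo torsion (`W2.stub_S1`), and `2R = ψ(φ R) ≡ m ψ(α)`, so `2 − m·(±2^ρ) = 0`, impossible for `ρ ≥ 2` — the step of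
`BlockFreeStructure.rhoIndex_eq_two_of_X_sq`.) [cite: TianYuanZhang2017, §1 (p0002 L101–L110)] [cite: SilvermanTate2015, §3.4 Prop. 3.7] -/
theorem rhoIndex_eq_two_of_ne_one {n : ℕ} (hsq : Squarefree n)
    (hrank : haveI := isElliptic_congruentNumberCurve hsq.ne_zero; (congruentNumberCurve n).mordellWeilRank = 1)
    (hne : (rhoSubgroup n).index ≠ 1) : (rhoSubgroup n).index = 2 := by
  haveI := isElliptic_congruentNumberCurve hsq.ne_zero
  obtain ⟨ρ, hρ⟩ := stub_S3 hsq
  obtain ⟨R, hR⟩ := stub_S0 (n := n) hrank.le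
  obtain ⟨α, hgen⟩ := stub_S0' (n := n) hrank.le
  obtain ⟨x₀, hx₀⟩ := LevelTwo.exists_not_isOfFinAddOrder_of_one_le_rank (congruentNumberCurve n) hrank.ge
  have hRnt : ¬ IsOfFinAddOrder R := LevelTwo.not_isOfFinAddOrder_of_generates hx₀ (hR x₀)
  obtain ⟨ε, hε, t₂, ht₂, hψ⟩ := stub_S1 hsq (ψQ n) xSqClass_eq_one_iff_exists_ψQ hρ hR hgen
  have ht₂' : IsOfFinAddOrder t₂ := isOfFinAddOrder_iff_nsmul_eq_zero.mpr ⟨2, two_pos, ht₂⟩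
  -- `ρ ≤ 1`: `2R = ψ(φ R)` and `φ R ≡ m α`
  have hρle : ρ ≤ 1 := by
    by_contra hρ2
    obtain ⟨m, hm⟩ := hgen ((congruentNumberCurve n).twoIsogenyFun R)
    have h2R : ψQ n ((congruentNumberCurve n).twoIsogenyFun R) = (2 : ℕ) • R := by
      change (congruentNumberCurve n).twoIsogenyDualHomOf _ = _
      rw [twoIsogenyDualHomOf_apply, twoIsogenyDualFun_twoIsogenyFun']
    have htor : IsOfFinAddOrder ((2 : ℤ) • R - (m * (ε * 2 ^ ρ)) • R) := by
      have h1 := (ψQ n).isOfFinAddOrder hm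
      rw [map_sub, map_zsmul, h2R, hψ] at h1
      have e : ((2 : ℕ) • R - m • ((ε * 2 ^ ρ) • R + t₂)) + m • t₂ = (2 : ℤ) • R - (m * (ε * 2 ^ ρ)) • R := by
        rw [show (2 : ℕ) • R = (2 : ℤ) • R from (natCast_zsmul R 2).symm]; module
      rw [← e]; exact h1.add ht₂'.zsmul
    rw [← sub_smul] at htor
    have hcoef : (2 : ℤ) - m * (ε * 2 ^ ρ) ≠ 0 := by
      obtain ⟨j, rfl⟩ : ∃ j, ρ = j + 2 := ⟨ρ - 2, by omega⟩
      intro h0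
      have : (2 : ℤ) = 4 * (m * ε * 2 ^ j) := by linear_combination h0
      omega
    exact hRnt (LevelTwo.isOfFinAddOrder_of_zsmul hcoef htor)
  -- `ρ ≠ 0`
  have hρ0 : ρ ≠ 0 := by rintro rfl; exact hne (by simpa using hρ)
  have hρ1 : ρ = 1 := by omega
  rw [hρ, hρ1, pow_one]

section R2

variable {l q : ℕ} [hlp : Fact l.Prime] [hqp : Fact q.Prime]

omit hlp hqp in
/-- `n = lq ≡ 7 (mod 8)` on R2. [folklore] -/
theorem mod_eight_R2 (hl8 : l % 8 = 1) (hq8 : q % 8 = 7) : (l * q) % 8 = 7 := by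
  rw [Nat.mul_mod, hl8, hq8]

/-- `n = lq` on R2 is block-free: no divisor `≡ 5 (mod 8)` (the divisors are `1, l, q, lq ≡ 1, 1, 7, 7`). [folklore] -/
theorem noBlock_R2 (hl8 : l % 8 = 1) (hq8 : q % 8 = 7) : ∀ d ∈ (l * q).divisors, d % 8 ≠ 5 := by
  intro d hd
  have hdvd := Nat.dvd_of_mem_divisors hd
  obtain ⟨a, b, ha, hb, rfl⟩ := Nat.dvd_mul.mp hdvd
  rcases (Nat.dvd_prime hlp.out).mp ha with rfl | rfl <;>
    rcases (Nat.dvd_prime hqp.out).mp hb with rfl | rfl <;> simp [Nat.mul_mod, hl8, hq8]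

/-- **`ρ(lq) = 1` on R2 ∩ {`Ш(A_{lq})[2] = 0`}** (T1 + `ρ ≤ 1`): rank `1`, `#Sel₂(E_{lq}) = 2⁵`, a `2`-torsion-free partner.
[cite: TianYuanZhang2017, §1 (p0002 L101–L110)] [cite: SilvermanAEC2009, Thm. X.4.2(a), Prop. X.4.9] -/
theorem rhoIndex_eq_two_of_partner_R2 (hl8 : l % 8 = 1) (hq8 : q % 8 = 7)
    (hlq : IsSquare ((l : ℤ) : ZMod q)) (hql : IsSquare ((q : ℤ) : ZMod l))
    (hr : haveI := isElliptic_congruentNumberCurve (Nat.mul_ne_zero hlp.out.ne_zero hqp.out.ne_zero);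
      (congruentNumberCurve (l * q)).mordellWeilRank = 1)
    (h₂ : haveI := isElliptic_congruentNumberCurve (Nat.mul_ne_zero hlp.out.ne_zero hqp.out.ne_zero);
      Nat.card ((congruentNumberCurve (l * q)).selmerGroup 2) = 2 ^ 5)
    (hA : ∀ c ∈ (congruentNumberCurve (l * q)).twoIsogenyCodomain.sha, 2 • c = 0 → c = 0) :
    (rhoSubgroup (l * q)).index = 2 := by
  have hlq_ne : l ≠ q := by rintro rfl; omega
  obtain ⟨hsq, -⟩ := squarefree_and_one_lt_R2 (l := l) (q := q) hlq_ne
  exact rhoIndex_eq_two_of_ne_one hsq hr (rhoIndex_ne_one_and_selmerFour_of_partner_R2 hl8 hq8 hlq hql hr h₂ hA).1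

/-- **THE LOWER HALF OF C⁺ ON R2 ∩ {`Ш(A_{lq})[2] = 0`}, `ρ` derived** (granted GZK and TYZ §3 as displayed, `tyz_cmPointCompositumData`): primes
`l ≡ 1`, `q ≡ 7 (mod 8)`, `(l/q) = (q/l) = 1`, `ord_{s=1} L(E_{lq}, s) = 1`, `#Sel₂(E_{lq}) = 2⁵`, `Ш(A_{lq})[2] = 0` ⟹ **`2 ∣ L` for every `L` with
`𝓛(lq)² = L²`**. [cite: TianYuanZhang2017, §1, §3.1 (p0011 L58–L66), Thm. 3.5, Lemma 3.18] [cite: Darmon2004, Thm. 3.22] -/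
theorem two_dvd_scriptL_of_partner_R2 (hF : tyz_cmPointCompositumData) (hGZK : rank_eq_analyticRank_of_analyticRank_le_one)
    (hl8 : l % 8 = 1) (hq8 : q % 8 = 7) (hlq : IsSquare ((l : ℤ) : ZMod q)) (hql : IsSquare ((q : ℤ) : ZMod l))
    (hr1 : haveI := isElliptic_congruentNumberCurve (Nat.mul_ne_zero hlp.out.ne_zero hqp.out.ne_zero);
      (congruentNumberCurve (l * q)).analyticRank = 1)
    (h₂ : haveI := isElliptic_congruentNumberCurve (Nat.mul_ne_zero hlp.out.ne_zero hqp.out.ne_zero);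
      Nat.card ((congruentNumberCurve (l * q)).selmerGroup 2) = 2 ^ 5)
    (hA : ∀ c ∈ (congruentNumberCurve (l * q)).twoIsogenyCodomain.sha, 2 • c = 0 → c = 0) :
    ∀ L : ℤ, IsScriptL (l * q) L → (2 : ℤ) ∣ L := by
  have hlq_ne : l ≠ q := by rintro rfl; omega
  obtain ⟨hsq, -⟩ := squarefree_and_one_lt_R2 (l := l) (q := q) hlq_ne
  haveI := isElliptic_congruentNumberCurve hsq.ne_zero
  have hrank : (congruentNumberCurve (l * q)).mordellWeilRank = 1 := (hGZK _ hr1.le).1.trans hr1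
  have hρ := rhoIndex_eq_two_of_partner_R2 hl8 hq8 hlq hql hrank h₂ hA
  exact two_dvd_scriptL_of_rhoIndex_eq_two_of_facts' hF hGZK hsq (mod_eight_R2 hl8 hq8) (noBlock_R2 hl8 hq8) hr1 hρ

/-- **C⁺ ON R2 ∩ {`Ш(A_{lq})[2] = 0`} ⟺ `[P(lq)] ≠ 0`, with `#Sel₄ = 2⁶` DISCHARGED** (display form): primes `l ≡ 1`, `q ≡ 7 (mod 8)` with
`(l/q) = (q/l) = 1`, `ord_{s=1} L(E_{lq}, s) = 1`, GZK, `#Sel₂(E_{lq}) = 2⁵`, `Ш(A_{lq})[2] = 0`, and the displayed data `D : GenusPointData (lq)` (TYZ §3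
printed statements + the compositum sentence): the conclusion of C⁺ at `lq` holds **iff TYZ's point `P(lq)` is NOT `2`-divisible in `A(ℍ′_{lq})`
modulo torsion**.  Here `ρ(lq) = 1` and the jump-one condition `#Sel₄(E_{lq}) = 2⁶` are THEOREMS (T1), not hypotheses: this is the `Sel₄`-free
residual of item 23431 on the sub-sector. [cite: TianYuanZhang2017, §1 (p0002 L101–L110), §3.1, Thm. 3.5 (p0011 L94–L100), Lemma 3.18]
[cite: SilvermanAEC2009, Thm. X.4.2(a), Prop. X.4.9] [cite: Darmon2004, Thm. 3.22] -/
theorem levelTwo_iff_genusPoint_not_twoDivisible_of_partner_R2 (hGZK : rank_eq_analyticRank_of_analyticRank_le_one)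
    (hl8 : l % 8 = 1) (hq8 : q % 8 = 7) (hlq : IsSquare ((l : ℤ) : ZMod q)) (hql : IsSquare ((q : ℤ) : ZMod l))
    (hr1 : haveI := isElliptic_congruentNumberCurve (Nat.mul_ne_zero hlp.out.ne_zero hqp.out.ne_zero);
      (congruentNumberCurve (l * q)).analyticRank = 1)
    (h₂ : haveI := isElliptic_congruentNumberCurve (Nat.mul_ne_zero hlp.out.ne_zero hqp.out.ne_zero);
      Nat.card ((congruentNumberCurve (l * q)).selmerGroup 2) = 2 ^ 5)
    (hA : ∀ c ∈ (congruentNumberCurve (l * q)).twoIsogenyCodomain.sha, 2 • c = 0 → c = 0)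
    (D : GenusPointData (l * q)) (hPr : D.Printed) (hC : D.CMPointCompositumPrinted) :
    (∀ L : ℤ, IsScriptL (l * q) L → (2 : ℤ) ∣ L ∧ ¬ (4 : ℤ) ∣ L) ↔
      ¬ ∃ y : APoint D.H, IsOfFinAddOrder (D.P (l * q) - (2 : ℤ) • y) := by
  have hlq_ne : l ≠ q := by rintro rfl; omega
  obtain ⟨hsq, -⟩ := squarefree_and_one_lt_R2 (l := l) (q := q) hlq_ne
  haveI := isElliptic_congruentNumberCurve hsq.ne_zero
  have hrank : (congruentNumberCurve (l * q)).mordellWeilRank = 1 := (hGZK _ hr1.le).1.trans hr1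
  have hρ := rhoIndex_eq_two_of_partner_R2 hl8 hq8 hlq hql hrank h₂ hA
  exact levelTwo_iff_genusPoint_not_twoDivisible_of_rhoIndex_eq_two hGZK hsq (mod_eight_R2 hl8 hq8) (noBlock_R2 hl8 hq8) hr1 D hPr hC hρ

end R2

end Summit.BirchSwinnertonDyer.PrintCf2.PartnerSha

end
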